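import Summits.Ventures.PercRepro.C026SeriesParallel
import Summits.Ventures.PercRepro.C026UpTo5

/-!
# C-026 at every `p` on every marked multigraph that series–parallel–pendant-reduces to at most five
live vertices (p6, gen 10)

The second endpoint of the reduction chain of `C026SeriesParallel.lean`: after the chain, delete the dead
edges (p4's `DeadEdges.lean`) AND the vertices that became isolated — the `liveGraph` on the `LiveSupp`
(the marks and the endpoints of live edges) — and apply p5's kernel theorem `c026UpTo5` (C-026 on every
multigraph with at most five vertices, at every `p`).

* `weight_pullConfig`, **`law3_map`** — the partition law of the marks transports along an endpoint-preserving
  edge bijection with a vertex map injective on the support (A2's `conn_map_iff`);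
* `LiveSupp`, `liveGraph`, `law3_liveGraph` — the law of `G` at `p` is the law of the live graph;
* **`C026At_of_card_liveSupp_le_five`**, **`C026At_of_reduces_small`** — C-026 at `p` for every instance that
  reduces to at most five live vertices: every series–parallel network on the three marks with at most two
  further branch vertices, with arbitrary subdivisions, parallel copies and pendant trees.  (With three
  marks among ≤ 5 live vertices at most two non-marks are live, so such a live graph is also hub-pair: the
  class coincides with that of `C026At_of_reduces_hubPair`; the endpoint is kept as the direct route through
  the kernel theorem, and `law3_map` as a general tool.)
-/

namespace PercRepro

open Finset

namespace MultiGraph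

section LawTransport

variable {VA EA VB EB : Type*} [Fintype EA] [Fintype EB]
  {A : MultiGraph VA EA} {B : MultiGraph VB EB} {ε : EA ≃ EB} {φ : VA → VB} {a b c : VA}

/-- The weight of a pulled-back configuration under the pulled-back weights. -/
theorem weight_pullConfig (p : EB → ℝ) (ω : Config EB) :
    weight (fun e => p (ε e)) (pullConfig ε ω) = weight p ω := by
  unfold weight
  exact Fintype.prod_equiv ε _ _ fun _ => rfl

omit [Fintype EA] [Fintype EB] in
/-- The vector of the images of the marks. -/
theorem map_vec3 : (fun i => φ ((![a, b, c] : Fin 3 → VA) i)) = ![φ a, φ b, φ c] := by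
  funext i
  fin_cases i <;> rfl

/-- **The partition law transports** along an endpoint-preserving edge bijection `ε` and a vertex map `φ`
injective on the support (A2's `conn_map_iff`). -/
theorem law3_map [DecidableEq EA] [DecidableEq EB] (hfst : ∀ e, B.fst (ε e) = φ (A.fst e))
    (hsnd : ∀ e, B.snd (ε e) = φ (A.snd e))
    (hinj : ∀ x y, A.Supp a b c x → A.Supp a b c y → φ x = φ y → x = y) (p : EB → ℝ) :
    A.law3 (fun e => p (ε e)) a b c = B.law3 p (φ a) (φ b) (φ c) := by
  funext s
  unfold law3 prob
  rw [← (pullEquiv ε).sum_comp]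
  refine Finset.sum_congr rfl fun ω _ => ?_
  simp only [pullEquiv_apply]
  have hmem : pullConfig ε ω ∈ A.partitionEvent ![a, b, c] (rgs3 s) ↔
      ω ∈ B.partitionEvent ![φ a, φ b, φ c] (rgs3 s) := by
    rw [← map_vec3 (φ := φ)]
    simp only [partitionEvent, Set.mem_setOf_eq]
    refine forall_congr' fun i => forall_congr' fun j => ?_
    rw [conn_map_iff hfst hsnd hinj (supp_mark (by fin_cases i <;> simp))
      (supp_mark (by fin_cases j <;> simp))]
  by_cases h : ω ∈ B.partitionEvent ![φ a, φ b, φ c] (rgs3 s)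
  · rw [Set.indicator_of_mem (hmem.2 h), Set.indicator_of_mem h, weight_pullConfig]
  · rw [Set.indicator_of_notMem (fun h' => h (hmem.1 h')), Set.indicator_of_notMem h]

end LawTransport

section Small

variable {V E : Type} [Fintype V] [Fintype E] [DecidableEq E]

/-- **The live support** of `(G, p)` with the marks `a, b, c`: the marks and the endpoints of the live
edges (`p e ≠ 0`). -/
def LiveSupp (G : MultiGraph V E) (p : E → ℝ) (a b c : V) (v : V) : Prop :=
  v = a ∨ v = b ∨ v = c ∨ ∃ e, p e ≠ 0 ∧ (G.fst e = v ∨ G.snd e = v)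

/-- **The live graph**: the live edges on the live support. -/
def liveGraph (G : MultiGraph V E) (p : E → ℝ) (a b c : V) :
    MultiGraph {v // G.LiveSupp p a b c v} {e // p e ≠ 0} where
  fst e := ⟨G.fst e.1, Or.inr (Or.inr (Or.inr ⟨e.1, e.2, Or.inl rfl⟩))⟩
  snd e := ⟨G.snd e.1, Or.inr (Or.inr (Or.inr ⟨e.1, e.2, Or.inr rfl⟩))⟩

/-- The live edges are the face of the live configuration. -/
def liveEdgeEquiv (p : E → ℝ) : {e // p e ≠ 0} ≃ Face (liveConfig p) ⊥ :=
  Equiv.subtypeEquivRight fun e => by simp [liveConfig]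

omit [Fintype V] in
/-- **The law of `G` at `p` is the law of the live graph at the live weights.** -/
theorem law3_liveGraph (G : MultiGraph V E) (p : E → ℝ) (a b c : V) :
    (G.liveGraph p a b c).law3 (fun e => p e.1) ⟨a, Or.inl rfl⟩ ⟨b, Or.inr (Or.inl rfl)⟩
        ⟨c, Or.inr (Or.inr (Or.inl rfl))⟩ = G.law3 p a b c := by
  classical
  rw [G.law3_eq_liveMinor p a b c]
  have hfst : ∀ e : {e // p e ≠ 0}, (G.minor (liveConfig p) ⊥).fst (liveEdgeEquiv p e) =
      (fun w : {v // G.LiveSupp p a b c v} => G.sureClass ⊥ w.1) ((G.liveGraph p a b c).fst e) :=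
    fun _ => rfl
  have hsnd : ∀ e : {e // p e ≠ 0}, (G.minor (liveConfig p) ⊥).snd (liveEdgeEquiv p e) =
      (fun w : {v // G.LiveSupp p a b c v} => G.sureClass ⊥ w.1) ((G.liveGraph p a b c).snd e) :=
    fun _ => rfl
  have hinj : ∀ x y : {v // G.LiveSupp p a b c v},
      (G.liveGraph p a b c).Supp ⟨a, Or.inl rfl⟩ ⟨b, Or.inr (Or.inl rfl)⟩
        ⟨c, Or.inr (Or.inr (Or.inl rfl))⟩ x →
      (G.liveGraph p a b c).Supp ⟨a, Or.inl rfl⟩ ⟨b, Or.inr (Or.inl rfl)⟩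
        ⟨c, Or.inr (Or.inr (Or.inl rfl))⟩ y →
      (fun w : {v // G.LiveSupp p a b c v} => G.sureClass ⊥ w.1) x =
        (fun w : {v // G.LiveSupp p a b c v} => G.sureClass ⊥ w.1) y → x = y :=
    fun x y _ _ hxy => Subtype.ext ((G.sureClass_bot_eq_iff _ _).1 hxy)
  exact law3_map hfst hsnd hinj (faceWeight p (liveConfig p) ⊥)

open Classical in
/-- **C-026 at `p` when at most five vertices are live** (the marks included): p5's `c026UpTo5` on the
live graph. -/
theorem C026At_of_card_liveSupp_le_five (G : MultiGraph V E) {p : E → ℝ} (hp : IsProb p) (a b c : V)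
    (h : Fintype.card {v // G.LiveSupp p a b c v} ≤ 5) : G.C026At p a b c := by
  unfold C026At
  rw [← G.law3_liveGraph p a b c]
  exact c026UpTo5 h (G.liveGraph p a b c) (fun e => p e.1) (fun e => hp e.1) _ _ _

open Classical in
/-- **C-026 for every instance that series–parallel–pendant-reduces to at most five live vertices.** -/
theorem C026At_of_reduces_small {a b c : V} {G G' : MultiGraph V E} {p p' : E → ℝ} (hp : IsProb p)
    (h : Reduces3 a b c (G, p) (G', p'))
    (hcard : Fintype.card {v // G'.LiveSupp p' a b c v} ≤ 5) : G.C026At p a b c :=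
  C026At_of_reduces' h (G'.C026At_of_card_liveSupp_le_five (h.isProb hp) a b c hcard)

end Small

end MultiGraph

end PercRepro
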